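import Mathlib
import HarnessLib
import HarnessLib.Audit
import Summits.NavierStokesRegularity.Statement
import Literature.Analysis.FluidPDE.ClassicalSolution
import Literature.Analysis.FluidPDE.LerayHopf
import Literature.Analysis.FluidPDE.SuitableWeak
import Summits.NavierStokesRegularity.NavierStokesRegularity.Theorems.NoBlowupToClay
import Literature.Analysis.FluidPDE.NSCriticalClosureHolds
import Literature.Analysis.FluidPDE.SelfSimilarLiouville
import HarnessLib.Audit.Status.Attr

/-!
Route: RootDecompL3RateLadder

# Route RootDecompL3RateLadder — Root decomposition g2 — Clay (A) ⟺ no slow blow-up (L³ double-log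
gauge) ∧ fast blow-up is Type I ∧ no Type-I blow-up — the L3RateLadder node

ROOT DECOMPOSITION CELL decomp-ns (D-0178/D-0179, RESIDUAL MODE, blocker-first), generation 2,
route-writer decomp-ns-writer-1:
the critic-CLEARED lens-1 (g2) node L3RateLadder («grading / quantitative ladder», axis (iii) of the
cell = the critical-norm RATE;
CRITIC-LEDGER row 24, CLEARED 2026-08-30T02:46:03Z, no objection; lens file
HOME/decomp-ns-lens-1/L3RateLadder.lean sha256
8e8b019ddbaf9ac61e158838867163ce948a61e5f3f46c66f5efcfcd1f2fa47e, 627 lines, lean rc 0 / 0 sorry / 0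
warnings, kernel `closes` (3 binders used) and
`root_iff_pieces : NavierStokesRegularity ↔ NoSlowBlowup ∧ FastBlowupIsTypeI ∧ NoTypeIBlowup`
(EXACT), rung theorems `gaugeCriterion_const`
(ESS, kernel from the LANDED `hasSmoothExtensionPast_of_eLpNorm_three_bounded_holds`),
`gaugeEscapeAt_one_lll` (Tao 2021 from the tree fact
`tao_L3_blowup_rate`), `axisymGaugeEscapeAt_one_ll` (Palasek 2021, vendored fact verbatim); BC7 by
the lens 3/3 CLEAN; census data files of
record HOME/census/COSTUME-CENSUS-v2.json sha256
05830338dcd56dc85a60276b05d4c6d88311c06479f2f16e07487067c2455ac6 and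
HOME/census/CASCADE-THRESHOLD.md sha256
245123b9…e5904e10 (HOME = run/shared/lean/pub/decomp-ns); TREE node N5 (fourth root file of the
cell; carves the BLOCKER B1 = stmt-0056 of the
frame A0 by the L³ RATE, an axis none of N1–N4 uses). TREE: ROOT `NavierStokesRegularity` (Clay (A))
⟺[EQUIV E0, blow-up language]
NoBlowup ⟸[AND, EXACT] NoSlowBlowup (X₁, crux, ATTACKED) ∧ FastBlowupIsTypeI (X₂, crux, DECLARED
RESIDUAL = B1 off the slow cells) ∧
NoTypeIBlowup (X₃ = stmt-1217 verbatim, DECLARED RESIDUAL of record). It suffices to show X = X₁ ∧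
X₂ ∧ X₃ with X₁ = «for SOME c > 0: a
classical solution on [0,T), Leray–Hopf from its rapidly decaying datum, whose L³ norm stays below
C·(log log (T−t)⁻¹)^c near T extends
smoothly past T» (an L³-RATE continuation criterion one rung above Tao 2021 Thm 1.4's triple log and
one rung below the Barker–Prange
(log)^(1/3) wall; = the symmetry-free Palasek 2021 statement), X₂ = «for EVERY c > 0: a maximal
smooth Leray–Hopf solution from a decaying
datum whose L³ norm is NOT O((log log (T−t)⁻¹)^c) blows up at the Type-I rate» (0056 minus the slow
cell), X₃ = no Type-I blow-up (1217).
X ⟺ S exactly (lens `root_iff_pieces`; S ⟹ each piece by vacuity through the landed NoBlowup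
bridge); B1-carving kernel:
`noTypeII_of_pieces : X₁ → X₂ → 0056`, `fastBlowupIsTypeI_of_noTypeII : 0056 → X₂`. Why this is
novel: no route of the census
(COSTUME-CENSUS-v2.json sha256 05830338dcd56dc85a60276b05d4c6d88311c06479f2f16e07487067c2455ac6, 27
rows) cuts Clay (A) or the blocker 0056 into
S-NECESSARY RATE CELLS — SubcubicESS (stmt-10671/10672/18288/18289) grades the SUFFICIENT road F(A)
(its rungs are not S-necessary),
QuarterLogPincer (23934/24077/24078) and Barker–Prange bound rates only UNDER a Type-I hypothesis
(the 1217 sector), L3TimeExponentPincer grades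
time exponents; here the cut is the GAUGE on the Type-II sector, every rung below the open cell and
the ceiling above it are theorems or named
facts, and the open cell X₁ is exactly one rung — Tao's scheme with one exponential removed — with
its axisymmetric instance decided (Palasek).
Lean: `NoSlowBlowup ∧ FastBlowupIsTypeI ∧ NoTypeIBlowup`

## Assembly
Pure logic over the landed blow-up bridge (kernel-checked, 0 sorry): by
`Theorems.navierStokesRegularity_of_noBlowup` it suffices that every
classical Leray–Hopf solution from a decaying datum extends past any T; if one did not, it is
maximal; with the exponent c of X₁ either its L³
norm is O((log log)^c) — then X₁ extends it — or not — then X₂ makes the blow-up Type I and X₃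
extends it; both contradict maximality.

Rationale: WHY THIS LINE. The blow-up frame (E0: Clay (A) ⟺ no maximal smooth Leray–Hopf solution from a
decaying datum has finite lifespan, tree
`navierStokesRegularity_of_noBlowup` / `noBlowup_of_navierStokesRegularity`) makes S a statement
about blow-ups, and the critical-norm RATE
‖u(t)‖_(L³) against a gauge G(T−t) partitions blow-ups into a SLOW cell (O(G)) and a FAST cell — for
each G exactly (lens `noBlowup_iff_cells`,
kernel): NoBlowup ⟺ GaugeCriterion G ∧ FastCellTypeI G ∧ NoTypeIBlowup. The ladder of gauges is a
ladder of THEOREMS up to the open cell: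
G ≡ 1 is Escauriaza–Seregin–Šverák 2003 / Seregin 2012 (tree LANDED
`hasSmoothExtensionPast_of_eLpNorm_three_bounded_holds`, lens kernel
`gaugeCriterion_const` = the BC5 witness), G = (log log log)^c is Tao 2021 Thm 1.4
(arXiv:1908.04958; tree fact `tao_L3_blowup_rate`, proved
in the tree from the quantitative ESS main estimate), G = (log log)^c is OPEN in the general class
and PROVED for axisymmetric solutions by
Palasek 2021 Thm 2 (arXiv:2101.08586, [galaxy:pdf:3327933239271363760]) — the regime (axisymmetric
with swirl, AX) where S itself is open —
and the wall (log)^(1/3) (Barker–Prange 2021 Thm 1 / Cor 1, [corpus:paper:arxiv-2003.06717 p.3,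
p.6]) is where DSS/Type-I blow-ups live, i.e.
the 1217 hard core. Imported area: quantitative unique continuation / Carleman estimates (Tao's
quantitative ESS programme); what it buys: the
attacked piece X₁ has a NAMED technique (Tao's scheme with one exponential removed — the
pigeonholing over scales in the Carleman step, Tao
Rem. 1.6 — done by Palasek using the axis structure of Lei–Zhang / KNSS) and a first lemma (a
double-exponential quantitative ESS bound), while
the weight of the blocker 0056 is confined to the declared residual X₂ (blow-ups with ‖u‖₃ = (log
log)^(o(1)), excluded by nothing known).

RANKED CRUXES. #2 NoSlowBlowup (crux) — NO SLOW BLOW-UP (X₁) [tag WEAKER(evidence: S ⟹ X₁ kernel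
`noSlowBlowup_of_root`; X₁ is VACUOUS on every blow-up escaping (log log)^c — all Type-I, DSS
((log)^(1/3), Barker–Prange Cor 1), power-rate and cascade scenarios — so X₁ ⇏ S; separating family
named; converse X₁ ⟹ NoBlowup needs X₂ ∧ X₃) · ATTACKED piece of this filing · leaf ATTACKABLE
(technique named: Tao 2021 quantitative unique continuation with ONE exponential removed — ‖u‖_∞ ≤
exp exp(A^C) t^(−1/2) instead of `taoTripleExp`; Palasek 2021 Thm 2 does it under axisymmetry; BC3
skeleton: stub_doubleLogRate (the double-log L³ rate at ν = 1 in Tao's class = `tao_L3_blowup_rate`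
with one log removed) + stub_frameTransport (Tao-2013 localisation + unboundedness + rescaling,
bookkeeping)) · BC5: rung G ≡ 1 is the LANDED ESS theorem, rung (log log log)^c is Tao's tree fact,
the axisymmetric instance of X₁ itself is Palasek's theorem (vendored fact `PalasekAxisymL3Rate`,
verbatim tree decl) — decided where S (= AX) is open · UNDECIDED(test T-rate, census menu): whether
any MODEL blow-up (averaged cascade, dyadic) is slow — heuristically the averaged cascade has POWER
L³ rate, i.e. X₁ MODEL-VACUOUS] for SOME exponent c > 0: every classical solution of the unforced
system on [0,T) (ν > 0, T > 0) that is Leray–Hopf from its rapidly decaying datum and whose L³(ℝ³)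
norm satisfies ‖u(t)‖₃ ≤ C (log log (T−t)⁻¹)^c for t < T close to T extends smoothly past T.
[difficulty: L] (why it might fail: the third exponential in Tao's scheme may be essential without
axis structure (Carleman pigeonholing over scales, Tao 2021 Rem. 1.6), and a Type-II blow-up with
‖u(t)‖₃ ≍ (log log)^(c/2) for every c is excluded by nothing known.) [arXiv:1908.04958,
arXiv:2101.08586, arXiv:2003.06717, arXiv:2211.16215, arXiv:2411.06483]
#3 FastBlowupIsTypeI (crux) — FAST BLOW-UP IS TYPE I (X₂) [tag WEAKER(evidence: X₂ is the
RESTRICTION of the blocker 0056 to the fast cells — 0056 ⟹ X₂ KERNEL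
`fastBlowupIsTypeI_of_noTypeII`, S ⟹ X₂ kernel `fastBlowupIsTypeI_of_root`; X₂ is vacuous exactly on
the cell ‖u(t)‖₃ = (log log (T−t)⁻¹)^(o(1)) left open by Tao's triple log, so X₂ ⇏ 0056 as far as
any theorem knows; 0056 ⟸ X₁ ∧ X₂ kernel `noTypeII_of_pieces`; exactness of the B1-carving modulo
the Type-I floor `TypeIGaugeFloor` UNDECIDED(test T-floor: does Barker–Prange 2021 Prop 2 run under
the sup-rate bound `IsTypeIBlowup` instead of L^(3,∞)?)) · DECLARED RESIDUAL of this filing (honest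
label: B1 minus one rung, not a new attack) · leaf IDEA-NEEDED · BARRIER-LOADED like 0056 (a Type-II
blow-up at power L³ rate — Hou's scenario, the averaged cascade — sits in X₂'s cell) ·
INSTRUMENTABLE only through the next rung of the ladder] for EVERY c > 0: a maximal smooth solution
of the unforced system with lifespan T (ν > 0, T > 0), Leray–Hopf on [0,T] from its rapidly decaying
datum, whose L³ norm is NOT O((log log (T−t)⁻¹)^c) near T, blows up at the Type-I rate at T.
[difficulty: open-problem] (why it might fail: exactly why 0056 might fail — a Type-II singularity
escaping every double-log gauge (Hou's axisymmetric scenario arXiv:2107.06509; any axisymmetric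
blow-up is Type II by KNSS/Seregin) — minus nothing usable.) [arXiv:0709.3599, arXiv:2107.06509,
arXiv:1402.0290, arXiv:1908.04958]
#4 NoTypeIBlowup (crux) — NO TYPE-I BLOW-UP FOR CLAY DATA (X₃ = stmt-NavierStokesRegularity-1217
VERBATIM — dedup by signature; `noTypeIBlowup_iff_ladder : _ ↔ TypeICertificateLadder.NoTypeIBlowup
:= Iff.rfl` in the lens file) [tag KNOWN WEAKER than S (axisymmetric class settled: KNSS 2009 Thms
6.1–6.2, tree `knss_no_axisymmetric_typeI_holds`; proved rungs NRŠ/Tsai, Chae–Wolf,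
TypeICertificateLadder C ≤ 2.41; S ⟹ it by vacuity) · DECLARED RESIDUAL OF RECORD in this filing (it
is the ATTACKED piece of N4 RootDecompMarginalRate and laddered by TypeICertificateLadder /
ThreadingFlux / TypeILiouville / lens-5 SimilarityHorizon·OrderHorizon / lens-3; this node adds
nothing to it and files it by name only) · in THIS ladder it is the CEILING content: the (log)^(1/3)
wall of Barker–Prange is where DSS/Type-I blow-ups live] for every ν > 0, T > 0 and every classical
solution of the unforced system on [0,T) that is Leray–Hopf from a rapidly decaying datum and blows
up at most at the Type-I rate at T, the solution extends smoothly past T. [difficulty: open-problem]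
(why it might fail: a discretely self-similar or non-scale-periodic Type-I singularity
(Albritton–Barker class; Bradshaw–Tsai DSS solutions exist for every λ > 1) realised from a Schwartz
datum; Liouville for bounded ancient mild solutions is open.) [arXiv:0709.3599, arXiv:1811.00502,
arXiv:2003.06717, Tsai1998]

TWO-LAYER PLAN. No split at birth. Foreseen (lens, not filed): X₁ ⟸ a double-exponential
quantitative ESS bound (`tao_quantitative_ess` with one exponential
fewer) + the Tao-2021 §6 rate derivation + frame transport (the BC3 skeleton's two stubs); supports
the lens typed but the writer does not
file (parametric / routine): `TypeIGaugeFloor (llGauge c)` (UNDECIDED, test T-floor — with it the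
B1-carving is exact), `RescalingTransport`
(ν → 1, routine), `PalasekAxisymL3Rate` (vendored fact = tree decl verbatim, module not yet built on
the hub). First prover target:
stub_frameTransport (M) — it validates that the ladder's rate facts pay in the route's currency;
then the rung theorems `gaugeCriterion_const`
/ `gaugeEscapeAt_one_lll` can be landed from the lens file verbatim as supports of X₁.

KILL CRITERIA. (i) a Type-II blow-up (any exact NS setting, Clay data) with ‖u(t)‖₃ = O((log log
(T−t)⁻¹)^c) for some c: refutes X₁ as typed for that c
— X₁ is ∃ c, so the killer is a blow-up slow for EVERY c… (ii) honest version: X₁ is refuted only by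
a blow-up that is slow at every
double-log exponent, X₂ by a Type-II blow-up fast at some exponent (Hou's scenario would do it:
kills X₂, 0056 and (A) alike — summit decided
(C)); (iii) X₃ refuted (a Type-I Clay blow-up: kills (A)); (iv) 0056 proved elsewhere ⟹ X₂ moot and
the route reduces to X₁ ∧ 1217 — X₁ then
still carries content only if 0056's proof does not pass through an L³ rate; (v) a symmetry-free
double-log rate theorem in print (literature
watch T-Palasek-general; none as of arXiv:2411.06483) closes X₁ outright — the node then degenerates
to the frame one rung up (re-cut at G₁).

NOT DECOMPOSED YET. X₂ (leaf, residual) and X₃ (by name). The per-gauge lattice (`GaugeCriterion`,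
`FastCellTypeI`, `GaugeEscapeAt`, `TypeIGaugeFloor`,
`noBlowup_iff_cells`, `noTypeII_iff_cells_of_floor`, the antitone lemmas) lives in the lens file;
the writer inlines the double-log gauge into
the two pieces (definitionally equal to the lens decls) and ships a kernel Exactness record against
the born decls as route evidence.

CHEAPEST FALSIFIER. Literature lookup (run by the lens 2026-08-30, corpus fts+vec and galaxy;
re-read by the writer): a symmetry-free double-logarithmic L³
blow-up-rate theorem would make X₁ KNOWN (not false) and collapse the node by one rung — none found:
`lit search --hybrid "double logarithmic
blow-up rate Navier-Stokes L3"`, galaxy `"double logarithmic blow|log log log"` --star all → 0 on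
point beyond Palasek
[galaxy:pdf:3327933239271363760]; surveys arXiv:2211.16215 p.16 and arXiv:2411.06483 p.3 list the
general case as open. Second: the census
test T-rate (L³ growth exponent of the averaged cascade / dyadic models; expected power rate ⇒ X₁
model-vacuous, X₂ model-loaded) — cheap
(the CASCADE-THRESHOLD instrument already has the trajectories: ‖u‖₃ ≍ E^(1/2) N_n^(1/2) at T − t_n
≍ N_n^(−5/2) ⇒ ‖u‖₃ ≍ (T−t)^(−1/5)).

NUMBERS. Ladder constants: ESS gauge G ≡ 1 (theorem); Tao 2021: ‖u‖_∞ ≤ exp exp exp(A^C) t^(−1/2)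
under sup_t ‖u‖₃ ≤ A (Thm 1.2) ⇒ rate
limsup ‖u(t)‖₃ / (log log log (T−t)⁻¹)^c = ∞ (Thm 1.4); Palasek 2021 Thm 2 (axisymmetric): (log log
(T−t)⁻¹)^c; Barker–Prange 2021: Type-I /
DSS blow-ups have ∫_(B_δ) |u|³ ≥ c_M log(1/(T−t)) (Thm 1) and DSS realise the log rate (Cor 1) — the
wall (log)^(1/3) in L³. Census (cascade
instrument, sha256 245123b9…e5904e10): model L³ rate exponent −1/5 (power), i.e. fast cell.

DEFINITION REQUESTS. None: IsClassicalNSSolutionOn, IsLerayHopfOn, HasRapidSpatialDecay,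
HasSmoothExtensionPast, IsMaximalSmoothSolution, IsTypeIBlowup, eLpNorm,
volume, 𝓝[<] exist (lean search --decl each, lens + writer); the gauge is inlined (no `llGauge` def
needed in the tree).

Novelty: Searches (lens 2026-08-30, re-read by the writer): `lean search` for decls of shape `eLpNorm (u t) 3
… Real.log (Real.log …)` outside the
Literature rate facts (none); lit search / --hybrid «double logarithmic blow-up rate Navier–Stokes
critical L3 norm»; lit galaxy search
«double logarithmic blow|log log log» --star all; rg over Theses/*.lean for eLpNorm … 3
(SubcubicESS, QuarterLogPincer, L3TimeExponentPincer,
CriticalL3Closure); ledger negatives (5 entries, none near X₁/X₂).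
Nearest prior art found: [corpus:paper:arxiv-2003.06717 p.3, p.6] Barker–Prange 2021 (rates under
Type I; the wall); Tao 2021 arXiv:1908.04958
Thm 1.4 / Rem 1.6 (triple log; where the exponentials come from); [galaxy:pdf:3327933239271363760]
Palasek 2021 = arXiv:2101.08586 Thm 2
(double log, axisymmetric); in tree: SubcubicESS 10671/10672/18288/18289 (sufficient road),
QuarterLogPincer 23934/24077/24078 (Type-I sector).
Delta: the node cuts the BLOCKER 0056 (Type-II sector) into S-necessary RATE CELLS by a gauge, so
that the open content of the attacked cell is
exactly one rung of Tao's quantitative programme (one exponential) with its axisymmetric instance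
already a theorem — no existing route states
an S-necessary L³-rate cell, and none places the blocker's residue (X₂) against a theorem-ceiling
((log)^(1/3)).
Claimed grade: new-combination  [refs: 1908.04958, 2101.08586, paper:arxiv-2003.06717]

Barriers (technique_class: quantitative-unique-continuation, carleman, L3-rate): - technique_class: quantitative-unique-continuation, carleman, L3-rate
- Literature.Barriers.NavierStokesRegularity.EnergySupercriticality: X₁ is OUTSIDE — its hypothesis
is a bound on the CRITICAL norm L³ (up to
  a double log), not an energy-class quantity, and its lever is backward uniqueness / quantitative
unique continuation (ESS–Tao), which the
  barrier's class (energy methods, supercritical a-priori control) does not cover; X₂ and X₃ are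
INSIDE exactly as 0056 and 1217 are — no
  evasion claimed (X₂ declared residual, X₃ residual of record).
- Literature.Barriers.NavierStokesRegularity.TaoAveragedBlowup: X₁ OUTSIDE — the averaged equation
destroys the pointwise structure the
  Carleman / backward-uniqueness step uses (named in AveragedTypeIBlowup `evasions_known`:
«regularity under a bounded critical norm via backward
  uniqueness … relies on controlling the nonlinearity pointwise»); heuristically Tao's cascade blows
up at POWER L³ rate ((T−t)^(−1/5)), i.e. in
  X₂'s cell, so X₁ is not loaded by it and X₂ is (test T-rate recorded). X₂: inside, like 0056.
- Literature.Barriers.NavierStokesRegularity.AveragedTypeIBlowup: X₁ outside (same lever; the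
entry's own `evasions_known`); X₃ inside if
  attacked abstractly (placed by N4 / its routes: Type-I exclusion must use exact-equation structure
— ε-regularity, backward uniqueness).
- Literature.Barriers.NavierStokesRegularity.NSITypeIIBlowup: X₁ OUTSIDE — Ożański's NSI blow-up has
‖u‖_(L³) → ∞ at a power rate (the entry's


sub-problem: NavierStokesRegularity · status: open · opened planner-decomp-ns-writer-1-g2-0 2026-08-30T03:03:34Z · rev 0 · ledger route-NavierStokesRegularity-RootDecompL3RateLadder
GENERATED by the gate from the ledger (D-0016/17). Provers cite these decls: `theorem foo : Summit.NavierStokesRegularity.NavierStokesRegularity.Theses.RootDecompL3RateLadder.<Decl> := …` in Summits/NavierStokesRegularity/NavierStokesRegularity/Theorems/<Name>.lean.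
-/

namespace Summit.NavierStokesRegularity.NavierStokesRegularity.Theses.RootDecompL3RateLadder

open scoped BigOperators Topology Manifold Classical MeasureTheory ProbabilityTheory Matrix InnerProductSpace ComplexConjugate ContinuousMap
open Filter Set Function TopologicalSpace MeasureTheory

attribute [summit_statement] _root_.NavierStokesRegularity

open Literature.NS

/-- item stmt-NavierStokesRegularity-26177 · crux · rank 2 · open · by planner
why it might fail: the third exponential in Tao's scheme may be essential without axis structure (Carleman pigeonholing over scales, Tao 2021 Rem. 1.6), and a Type-II blow-up with ‖u(t)‖₃ ≍ (log log)^(c/2) for every c is excluded by nothing known.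
sources: arXiv:1908.04958, arXiv:2101.08586, arXiv:2003.06717, arXiv:2211.16215, arXiv:2411.06483
[crux] NO SLOW BLOW-UP (X₁) [tag WEAKER(evidence: S ⟹ X₁ kernel `noSlowBlowup_of_root`; X₁ is
VACUOUS on every blow-up escaping (log log)^c — all Type-I, DSS ((log)^(1/3), Barker–Prange Cor 1),
power-rate and cascade scenarios — so X₁ ⇏ S; separating family named; converse X₁ ⟹ NoBlowup needs
X₂ ∧ X₃) · ATTACKED piece of this filing · leaf ATTACKABLE (technique named: Tao 2021 quantitative
unique continuation with ONE exponential removed — ‖u‖_∞ ≤ exp exp(A^C) t^(−1/2) instead of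
`taoTripleExp`; Palasek 2021 Thm 2 does it under axisymmetry; BC3 skeleton: stub_doubleLogRate (the
double-log L³ rate at ν = 1 in Tao's class = `tao_L3_blowup_rate` with one log removed) +
stub_frameTransport (Tao-2013 localisation + unboundedness + rescaling, bookkeeping)) · BC5: rung G
≡ 1 is the LANDED ESS theorem, rung (log log log)^c is Tao's tree fact, the axisymmetric instance of
X₁ itself is Palasek's theorem (vendored fact `PalasekAxisymL3Rate`, verbatim tree decl) — decided
where S (= AX) is open · UNDECIDED(test T-rate, census menu): whether any MODEL blow-up (averaged
cascade, dyadic) is slow — heuristically the averaged cascade has POWER L³ rate, i.e. X₁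
MODEL-VACUOUS] for SOME exponent c > 0 -/
@[route_item "route-NavierStokesRegularity-RootDecompL3RateLadder", crux]
def NoSlowBlowup : Prop :=
  ∃ c : ℝ, 0 < c ∧ ∀ (ν T : ℝ), 0 < ν → 0 < T → ∀ (u : ℝ → EuclideanSpace ℝ (Fin 3) → EuclideanSpace ℝ (Fin 3)) (p : ℝ → EuclideanSpace ℝ (Fin 3) → ℝ), Literature.Analysis.FluidPDE.IsClassicalNSSolutionOn (Set.Ico 0 T) ν 0 u p → Literature.Analysis.FluidPDE.IsLerayHopfOn T ν 0 (u 0) u → Literature.Analysis.FluidPDE.HasRapidSpatialDecay (u 0) → (∃ C : ℝ, ∀ᶠ t in 𝓝[<] T, eLpNorm (u t) 3 volume ≤ ENNReal.ofReal (C * Real.log (Real.log (T - t)⁻¹) ^ c)) → Literature.Analysis.FluidPDE.HasSmoothExtensionPast ν 0 u T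

/-- item stmt-NavierStokesRegularity-26178 · crux · rank 3 · open · by planner
why it might fail: exactly why 0056 might fail — a Type-II singularity escaping every double-log gauge (Hou's axisymmetric scenario arXiv:2107.06509; any axisymmetric blow-up is Type II by KNSS/Seregin) — minus nothing usable.
sources: arXiv:0709.3599, arXiv:2107.06509, arXiv:1402.0290, arXiv:1908.04958
[crux] FAST BLOW-UP IS TYPE I (X₂) [tag WEAKER(evidence: X₂ is the RESTRICTION of the blocker 0056
to the fast cells — 0056 ⟹ X₂ KERNEL `fastBlowupIsTypeI_of_noTypeII`, S ⟹ X₂ kernel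
`fastBlowupIsTypeI_of_root`; X₂ is vacuous exactly on the cell ‖u(t)‖₃ = (log log (T−t)⁻¹)^(o(1))
left open by Tao's triple log, so X₂ ⇏ 0056 as far as any theorem knows; 0056 ⟸ X₁ ∧ X₂ kernel
`noTypeII_of_pieces`; exactness of the B1-carving modulo the Type-I floor `TypeIGaugeFloor`
UNDECIDED(test T-floor: does Barker–Prange 2021 Prop 2 run under the sup-rate bound `IsTypeIBlowup`
instead of L^(3,∞)?)) · DECLARED RESIDUAL of this filing (honest label: B1 minus one rung, not a new
attack) · leaf IDEA-NEEDED · BARRIER-LOADED like 0056 (a Type-II blow-up at power L³ rate — Hou's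
scenario, the averaged cascade — sits in X₂'s cell) · INSTRUMENTABLE only through the next rung of
the ladder] for EVERY c > 0: a maximal smooth solution of the unforced system with lifespan T (ν >
0, T > 0), Leray–Hopf on [0,T] from its rapidly decaying datum, whose L³ norm is NOT O((log log
(T−t)⁻¹)^c) near T, blows up at the Type-I rate at T. [difficulty: open-problem] -/
@[route_item "route-NavierStokesRegularity-RootDecompL3RateLadder", crux]
def FastBlowupIsTypeI : Prop :=
  ∀ c : ℝ, 0 < c → ∀ (ν T : ℝ), 0 < ν → 0 < T → ∀ (u : ℝ → EuclideanSpace ℝ (Fin 3) → EuclideanSpace ℝ (Fin 3)) (p : ℝ → EuclideanSpace ℝ (Fin 3) → ℝ), Literature.Analysis.FluidPDE.IsMaximalSmoothSolution ν 0 u p T → Literature.Analysis.FluidPDE.IsLerayHopfOn T ν 0 (u 0) u → Literature.Analysis.FluidPDE.HasRapidSpatialDecay (u 0) → ¬ (∃ C : ℝ, ∀ᶠ t in 𝓝[<] T, eLpNorm (u t) 3 volume ≤ ENNReal.ofReal (C * Real.log (Real.log (T - t)⁻¹) ^ c)) → Literature.Analysis.FluidPDE.IsTypeIBlowup u T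

/-- item stmt-NavierStokesRegularity-1217 · crux · rank 4 · open · by planner
why it might fail: a discretely self-similar or non-scale-periodic Type-I singularity (Albritton–Barker class; Bradshaw–Tsai DSS solutions exist for every λ > 1) realised from a Schwartz datum; Liouville for bounded ancient mild solutions is open.
sources: arXiv:0709.3599, arXiv:1811.00502, arXiv:2003.06717, Tsai1998
[target] X = NO TYPE-I BLOW-UP FOR CLAY DATA: a classical solution of unforced NS on ℝ³×[0,T) which
is Leray–Hopf from a rapidly decaying datum and blows up at most at the Type-I rate ‖u(t)‖∞ ≤
C(T−t)^{-1/2} extends smoothly past T. Equals UnthreadedNoBlowup ∧ ThreadedNoBlowup by excluded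
middle on 'every point is unthreaded' (proved in the planner's Sketch.lean: target_of_cruxes); it is
the unconditional conclusion of stmt-NavierStokesRegularity-0058 (route TypeILiouville, which
assumes (L)). With NoTypeII (stmt-0056) it gives NoBlowup (stmt-0054). Card:
threading-flux-trace-topology. -/
@[route_item "route-NavierStokesRegularity-RootDecompL3RateLadder", crux]
def NoTypeIBlowup : Prop :=
  ∀ (ν T : ℝ), 0 < ν → 0 < T → ∀ (u : ℝ → EuclideanSpace ℝ (Fin 3) → EuclideanSpace ℝ (Fin 3)) (p : ℝ → EuclideanSpace ℝ (Fin 3) → ℝ), Literature.Analysis.FluidPDE.IsClassicalNSSolutionOn (Set.Ico 0 T) ν 0 u p → Literature.Analysis.FluidPDE.IsLerayHopfOn T ν 0 (u 0) u → Literature.Analysis.FluidPDE.HasRapidSpatialDecay (u 0) → Literature.Analysis.FluidPDE.IsTypeIBlowup u T → Literature.Analysis.FluidPDE.HasSmoothExtensionPast ν 0 u T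

/-- item stmt-NavierStokesRegularity-26179 · assembly · rank 1 · open · by planner
sources: Fefferman2000, EscauriazaSereginSverak2003
[assembly] the implication the glue proves: X₁ → X₂ → X₃ → Clay (A). -/
@[route_item "route-NavierStokesRegularity-RootDecompL3RateLadder"]
def Assembly : Prop :=
  NoSlowBlowup → FastBlowupIsTypeI → NoTypeIBlowup → NavierStokesRegularity

/-! D-0027 §2.1 — DECIDING THEOREM (planner-authored via `route open/edit --closes-file`; by planner-decomp-ns-writer-1-g2-0 2026-08-30T03:03:34Z):
its hypotheses are this route's items and its conclusion the sub-problem Statement (glue_lint), and it elaborates with this file. -/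

@[closes "route-NavierStokesRegularity-RootDecompL3RateLadder"] theorem closes (h₁ : NoSlowBlowup) (h₂ : FastBlowupIsTypeI) (h₃ : NoTypeIBlowup) :
    NavierStokesRegularity := by
  refine Theorems.navierStokesRegularity_of_noBlowup ?_
  intro ν T hν hT u p hcl hLH hdec
  obtain ⟨c, hc, hcrit⟩ := h₁
  by_contra hext
  have hmax : Literature.Analysis.FluidPDE.IsMaximalSmoothSolution ν 0 u p T := ⟨hcl, hext⟩
  by_cases hslow : ∃ C : ℝ, ∀ᶠ t in 𝓝[<] T, eLpNorm (u t) 3 volume ≤ ENNReal.ofReal (C * Real.log (Real.log (T - t)⁻¹) ^ c)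
  · exact hext (hcrit ν T hν hT u p hcl hLH hdec hslow)
  · exact hext (h₃ ν T hν hT u p hcl hLH hdec (h₂ c hc ν T hν hT u p hmax hLH hdec hslow))

end Summit.NavierStokesRegularity.NavierStokesRegularity.Theses.RootDecompL3RateLadder
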